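import Summits.CriticalPhenomena.PercolationContinuityZ3.Theorems.PercNearOneGluingNoHeavyLowerTailFourCopyCertAlgebra
import Summits.CriticalPhenomena.PercolationContinuityZ3.Theorems.PercNearOneGluingNoHeavyLowerTailSahiC3CubeCertCheck

/-!
# `NoHeavyLowerTail` (crux stmt-CriticalPhenomena-4575), master-family hierarchy P3: a kernel-checkable certificate that
# Sahi's FOURTH-order inequality `E₄ ≥ 0` holds for all quadruples of increasing events of the cube `{0,1}^m` under EVERY
# product measure — the checker and its soundness

Support file (seat `prim-masterthm-p3`; `--supports stmt-CriticalPhenomena-4575`).  Nothing here is specific to percolation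
and nothing is asserted about the crux.

Context.  Sahi [Combinatorica 28 (2008), Conj. 5] / Lieb–Sahi [arXiv:2107.09838, Def. 3.1]: for a product measure `μ_p` on
`{0,1}^m` and increasing `A, B, C, D`,
`E₄(A,B,C,D) = 6μ(ABCD) − 2Σμ(A_i)μ(A_jA_kA_l) + Σμ(A_i)μ(A_j)μ(A_kA_l) − Σμ(A_iA_j)μ(A_kA_l) − μ(A)μ(B)μ(C)μ(D) ≥ 0`
("C₄"; OPEN for every `m` in print; `C₄ ⇒ C₃` by branching `E₄(A,B,C,Ω) = 2E₃(A,B,C)`, tree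
`Literature.Probability.LatticeModels.sahiE4_univ`).  The master-family statement (M⁺-4) of the cell
(`run/shared/lean/prim/MASTER-FAMILY.md` §MASTER) is the COEFFICIENTWISE form: every degree-4 tensor-Bernstein coefficient
("level-4 comb coefficient", four copies) of `p ↦ E₄(μ_p; A,B,C,D)` is a nonnegative integer.  This file is the four-copy
analogue of `…SahiC3CubeCertCheck` (three copies): with the bitmask tables `tabN`/`tabZ` of that file and the four-copy
algebra of `…FourCopyCertAlgebra` (`quarticForm_nonneg`, `quarticCoef_nonneg_of_digit_ge`, base-5 Kronecker numbers `krN5`),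

* `krT5`, `zE4`, `checkQuad`, `checkQuad_sound` — the certificate number of `E₄` (fifteen products of four Kronecker numbers,
  missing factors = the full cube) and the digit test; if it passes, the quartic of the bitmask tables is `≥ 0` on `[0,1]^m`;
* `checkCube4Row m σ A`, `checkCube4 m σ` — the test over all SORTED quadruples of increasing bitmasks (`E₄` is symmetric),
  split into rows by the first bitmask so that the kernel can evaluate it piecewise; `checkQuad_of_checkCube4(Row)`, `checkCube4_of_rows`.

The bridge to events `A ⊆ Set (Fin m)` and `prodBernoulli` and the evaluations (`m ≤ 3`) are `…SahiC4CubeEvents` /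
`…SahiC4CubeLeThree`.  Census of the same integers outside the kernel (two independent programs, exact): all quadruple-multisets
of up-sets of `{0,1}^m`, `m ≤ 4` (ttrl2 `e4_comb.c` 2.79·10⁹ values; prim-sahi `sahicomb.c`), `0` negative; seat `prim-masterthm-p3`
`combk.c` reproduces the `m = 3` cell (239 085 interior values, 44 805 zeros) exactly.
-/

namespace Summit.CriticalPhenomena.PercolationContinuityZ3.Theorems.SahiC4Cube

open Finset OneCutCert FourCopyCert SahiC3Cube
open scoped BigOperators

/-! ## Kronecker numbers of bitmask tables, base-5 positions -/

/-- Kronecker number (base `2^σ`, base-5 positions) of a bitmask table. [this work] -/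
def krT5 (σ m T : ℕ) : ℕ := krN5 σ m (tabN m T)

/-- `krT5` is the Kronecker number `KR5` of the corner table. [this work] -/
theorem krT5_eq (σ m T : ℕ) : (krT5 σ m T : ℤ) = KR5 (2 ^ σ) (tabZ m T) := krN5_eq σ m _ (length_tabN m T)

/-! ## The certificate number of `E₄` and the digit test -/

/-- The certificate number of `E₄(A,B,C,D)` (every product padded to four factors with `F` = the number of the whole cube):
`6K(ABCD)F³ − 2[K(A)K(BCD)+K(B)K(ACD)+K(C)K(ABD)+K(D)K(ABC)]F² + [K(A)K(B)K(CD)+…+K(C)K(D)K(AB)]F`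
`− [K(AB)K(CD)+K(AC)K(BD)+K(AD)K(BC)]F² − K(A)K(B)K(C)K(D)`. [this work] -/
def zE4 (σ m : ℕ) (F : ℤ) (A B C D : ℕ) : ℤ :=
  let K : ℕ → ℤ := fun T => (krT5 σ m T : ℤ)
  6 * K (A &&& B &&& C &&& D) * F * F * F
    - 2 * (K A * K (B &&& C &&& D) + K B * K (A &&& C &&& D) + K C * K (A &&& B &&& D) + K D * K (A &&& B &&& C)) * F * F
    + (K A * K B * K (C &&& D) + K A * K C * K (B &&& D) + K A * K D * K (B &&& C) + K B * K C * K (A &&& D)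
        + K B * K D * K (A &&& C) + K C * K D * K (A &&& B)) * F
    - (K (A &&& B) * K (C &&& D) + K (A &&& C) * K (B &&& D) + K (A &&& D) * K (B &&& C)) * F * F
    - K A * K B * K C * K D

/-- The level-4 offset `2^(σ-1) · Σ_{j < 5^m} (2^σ)^j` as the mask number `maskN σ (5^m)` (computed by shifts — unlike the
closed form `FourCopyCert.offQ`, whose `Int` power the kernel evaluates by unary recursion on the exponent). [this work] -/
def offM (σ m : ℕ) : ℤ := (maskN σ (5 ^ m) : ℤ)

/-- The digit test of one quadruple with precomputed full-cube number `F`, offset `off` and its `toNat`. [this work] -/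
def checkQuadW (σ m : ℕ) (F off : ℤ) (offN : ℕ) (A B C D : ℕ) : Bool :=
  let Z := zE4 σ m F A B C D + off
  decide (0 ≤ Z) && decide ((Z.toNat &&& offN) = offN)

/-- The certificate CHECK of one quadruple of bitmasks in base `2^σ`: coefficient bound `24·16^m < 2^(σ-1)` and the AND-mask
digit test on `Z + offM`. [this work] -/
def checkQuad (σ m A B C D : ℕ) : Bool :=
  decide (0 < σ) && decide (24 * 16 ^ m < 2 ^ (σ - 1)) &&
    checkQuadW σ m (krT5 σ m (fullN m)) (offM σ m) (offM σ m).toNat A B C D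

/-- The signs of the fifteen quartic terms of `E₄` (set partitions of `{1,2,3,4}` by type: `{4}:+6`, `{1,3}:−2` ×4,
`{1,1,2}:+1` ×6, `{2,2}:−1` ×3, `{1,1,1,1}:−1`). [this work] -/
def sgn15 : Fin 15 → ℤ := ![6, -2, -2, -2, -2, 1, 1, 1, 1, 1, 1, -1, -1, -1, -1]

/-- First factors. [this work] -/
def X15 (m A B C D : ℕ) : Fin 15 → (Fin m → Bool) → ℤ :=
  ![tabZ m (A &&& B &&& C &&& D), tabZ m A, tabZ m B, tabZ m C, tabZ m D,
    tabZ m A, tabZ m A, tabZ m A, tabZ m B, tabZ m B, tabZ m C,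
    tabZ m (A &&& B), tabZ m (A &&& C), tabZ m (A &&& D), tabZ m A]

/-- Second factors. [this work] -/
def Y15 (m A B C D : ℕ) : Fin 15 → (Fin m → Bool) → ℤ :=
  ![tabZ m (fullN m), tabZ m (B &&& C &&& D), tabZ m (A &&& C &&& D), tabZ m (A &&& B &&& D), tabZ m (A &&& B &&& C),
    tabZ m B, tabZ m C, tabZ m D, tabZ m C, tabZ m D, tabZ m D,
    tabZ m (C &&& D), tabZ m (B &&& D), tabZ m (B &&& C), tabZ m B]

/-- Third factors. [this work] -/
def Z15 (m A B C D : ℕ) : Fin 15 → (Fin m → Bool) → ℤ :=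
  ![tabZ m (fullN m), tabZ m (fullN m), tabZ m (fullN m), tabZ m (fullN m), tabZ m (fullN m),
    tabZ m (C &&& D), tabZ m (B &&& D), tabZ m (B &&& C), tabZ m (A &&& D), tabZ m (A &&& C), tabZ m (A &&& B),
    tabZ m (fullN m), tabZ m (fullN m), tabZ m (fullN m), tabZ m C]

/-- Fourth factors. [this work] -/
def W15 (m D : ℕ) : Fin 15 → (Fin m → Bool) → ℤ :=
  ![tabZ m (fullN m), tabZ m (fullN m), tabZ m (fullN m), tabZ m (fullN m), tabZ m (fullN m),
    tabZ m (fullN m), tabZ m (fullN m), tabZ m (fullN m), tabZ m (fullN m), tabZ m (fullN m), tabZ m (fullN m),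
    tabZ m (fullN m), tabZ m (fullN m), tabZ m (fullN m), tabZ m D]

set_option maxHeartbeats 1600000 in
/-- **Soundness of `checkQuad`**: if the digit test passes, the quartic
`6ML(ABCD) − 2ΣML(A_i)ML(A_jA_kA_l) + ΣML(A_i)ML(A_j)ML(A_kA_l) − ΣML(A_iA_j)ML(A_kA_l) − ML(A)ML(B)ML(C)ML(D)` of the
bitmask tables is nonnegative at every point of the unit cube. [this work] -/
theorem checkQuad_sound {σ m A B C D : ℕ} (h : checkQuad σ m A B C D = true) {x : Fin m → ℝ} (hx : InCube x) :
    0 ≤ 6 * ML (tabR m (A &&& B &&& C &&& D)) x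
      - 2 * (ML (tabR m A) x * ML (tabR m (B &&& C &&& D)) x + ML (tabR m B) x * ML (tabR m (A &&& C &&& D)) x
          + ML (tabR m C) x * ML (tabR m (A &&& B &&& D)) x + ML (tabR m D) x * ML (tabR m (A &&& B &&& C)) x)
      + (ML (tabR m A) x * ML (tabR m B) x * ML (tabR m (C &&& D)) x + ML (tabR m A) x * ML (tabR m C) x * ML (tabR m (B &&& D)) x
          + ML (tabR m A) x * ML (tabR m D) x * ML (tabR m (B &&& C)) x + ML (tabR m B) x * ML (tabR m C) x * ML (tabR m (A &&& D)) x
          + ML (tabR m B) x * ML (tabR m D) x * ML (tabR m (A &&& C)) x + ML (tabR m C) x * ML (tabR m D) x * ML (tabR m (A &&& B)) x)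
      - (ML (tabR m (A &&& B)) x * ML (tabR m (C &&& D)) x + ML (tabR m (A &&& C)) x * ML (tabR m (B &&& D)) x
          + ML (tabR m (A &&& D)) x * ML (tabR m (B &&& C)) x)
      - ML (tabR m A) x * ML (tabR m B) x * ML (tabR m C) x * ML (tabR m D) x := by
  unfold checkQuad checkQuadW at h
  simp only [Bool.and_eq_true, decide_eq_true_eq] at h
  obtain ⟨⟨hσ, hbnd⟩, hZ, hland⟩ := h
  unfold offM at hZ hland
  rw [Int.toNat_natCast] at hland
  -- the certificate number is `quarticZ`
  have hZeq : zE4 σ m (krT5 σ m (fullN m)) A B C D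
      = quarticZ (2 ^ σ) sgn15 (X15 m A B C D) (Y15 m A B C D) (Z15 m A B C D) (W15 m D) := by
    unfold zE4 quarticZ
    simp only [Fin.sum_univ_succ, Fin.sum_univ_zero, sgn15, X15, Y15, Z15, W15, Matrix.cons_val_zero,
      Matrix.cons_val_succ, krT5_eq]
    ring
  -- the bound on the fibre sums
  have hB : CoefBound4 sgn15 (X15 m A B C D) (Y15 m A B C D) (Z15 m A B C D) (W15 m D) (2 ^ (σ - 1)) := by
    intro k
    have hX : ∀ j g, |X15 m A B C D j g| ≤ 1 := by intro j g; fin_cases j <;> exact abs_tabZ_le _ _ _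
    have hY : ∀ j g, |Y15 m A B C D j g| ≤ 1 := by intro j g; fin_cases j <;> exact abs_tabZ_le _ _ _
    have hZ' : ∀ j g, |Z15 m A B C D j g| ≤ 1 := by intro j g; fin_cases j <;> exact abs_tabZ_le _ _ _
    have hW : ∀ j g, |W15 m D j g| ≤ 1 := by intro j g; fin_cases j <;> exact abs_tabZ_le _ _ _
    have h16 : ∀ j, |sgn15 j * pcoef4 (X15 m A B C D j) (Y15 m A B C D j) (Z15 m A B C D j) (W15 m D j) k|
        ≤ |sgn15 j| * 16 ^ m := by
      intro j
      rw [abs_mul]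
      exact mul_le_mul_of_nonneg_left (abs_pcoef4_le _ _ _ _ (hX j) (hY j) (hZ' j) (hW j) k) (abs_nonneg _)
    have hsum : |quarticCoef sgn15 (X15 m A B C D) (Y15 m A B C D) (Z15 m A B C D) (W15 m D) k| ≤ 24 * 16 ^ m := by
      unfold quarticCoef
      calc |∑ j : Fin 15, sgn15 j * pcoef4 (X15 m A B C D j) (Y15 m A B C D j) (Z15 m A B C D j) (W15 m D j) k|
          ≤ ∑ j : Fin 15, |sgn15 j * pcoef4 (X15 m A B C D j) (Y15 m A B C D j) (Z15 m A B C D j) (W15 m D j) k| :=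
            Finset.abs_sum_le_sum_abs _ _
        _ ≤ ∑ j : Fin 15, |sgn15 j| * (16 : ℤ) ^ m := Finset.sum_le_sum fun j _ => h16 j
        _ = 24 * 16 ^ m := by
            simp only [Fin.sum_univ_succ, Fin.sum_univ_zero, sgn15, Matrix.cons_val_zero, Matrix.cons_val_succ]
            norm_num; ring
    have hpow : (24 : ℤ) * 16 ^ m < (2 : ℕ) ^ (σ - 1) := by exact_mod_cast hbnd
    exact lt_of_le_of_lt hsum hpow
  -- the digits
  set N : ℕ := (zE4 σ m (krT5 σ m (fullN m)) A B C D + maskN σ (5 ^ m)).toNat with hN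
  have hNZ : (N : ℤ) = quarticZ (2 ^ σ) sgn15 (X15 m A B C D) (Y15 m A B C D) (Z15 m A B C D) (W15 m D) +
      ∑ j : Fin (5 ^ m), (2 : ℤ) ^ (σ - 1) * (2 ^ σ) ^ (j : ℕ) := by
    rw [hN, Int.toNat_of_nonneg hZ, hZeq, maskN_eq_sum σ hσ, Fin.sum_univ_eq_sum_range
      (fun j => (2 : ℤ) ^ (σ - 1) * (2 ^ σ) ^ j) (5 ^ m)]
  have hdig : ∀ j : ℕ, j < 5 ^ m → 2 ^ (σ - 1) ≤ digit (2 ^ σ) N j := digit_ge_of_land σ hσ (5 ^ m) N hland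
  have hk : ∀ k, 0 ≤ quarticCoef sgn15 (X15 m A B C D) (Y15 m A B C D) (Z15 m A B C D) (W15 m D) k :=
    quarticCoef_nonneg_of_digit_ge hσ hB N hNZ hdig
  have hF : 0 ≤ quarticForm sgn15 (X15 m A B C D) (Y15 m A B C D) (Z15 m A B C D) (W15 m D) x := quarticForm_nonneg hk hx
  unfold quarticForm at hF
  simp only [Fin.sum_univ_succ, Fin.sum_univ_zero, sgn15, X15, Y15, Z15, W15, Matrix.cons_val_zero,
    Matrix.cons_val_succ] at hF
  have h1 : ML (fun g => ((tabZ m (fullN m) g : ℤ) : ℝ)) x = 1 := ML_fullN m x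
  rw [h1] at hF
  unfold tabR
  push_cast at hF
  linarith

/-! ## The check over all sorted quadruples of increasing bitmasks -/

/-- One ROW of the cube check: the digit test for every sorted quadruple `A ≤ B ≤ C ≤ D` of increasing bitmasks with the
given first member `A` (sharing `F` and the offset).  The level-4 cube check is split into rows so that each row can be
evaluated by the kernel separately (`m = 3`: 20 rows of ≤ 1 540 quadruples). [this work] -/
def checkCube4Row (m σ A : ℕ) : Bool :=
  let ups := upsN m
  let F : ℤ := krT5 σ m (fullN m)
  let off := offM σ m
  let offN := off.toNat
  decide (0 < σ) && decide (24 * 16 ^ m < 2 ^ (σ - 1)) &&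
    ups.all fun B => ups.all fun C => ups.all fun D =>
      decide (B < A) || decide (C < B) || decide (D < C) || checkQuadW σ m F off offN A B C D

/-- **The cube check (level 4)**: all rows, i.e. the digit test for every sorted quadruple of increasing bitmasks.
[this work] -/
def checkCube4 (m σ : ℕ) : Bool := (upsN m).all fun A => checkCube4Row m σ A

/-- A row certifies every sorted quadruple starting with its bitmask. [this work] -/
theorem checkQuad_of_checkCube4Row {m σ A : ℕ} (h : checkCube4Row m σ A = true) {B C D : ℕ}
    (hB : B ∈ upsN m) (hC : C ∈ upsN m) (hD : D ∈ upsN m) (hAB : A ≤ B) (hBC : B ≤ C) (hCD : C ≤ D) :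
    checkQuad σ m A B C D = true := by
  unfold checkCube4Row at h
  simp only [Bool.and_eq_true, decide_eq_true_eq, List.all_eq_true, Bool.or_eq_true] at h
  obtain ⟨⟨hσ, hbnd⟩, hall⟩ := h
  have := hall B hB C hC D hD
  unfold checkQuad
  simp only [Bool.and_eq_true, decide_eq_true_eq]
  refine ⟨⟨hσ, hbnd⟩, ?_⟩
  rcases this with ((h1 | h2) | h3) | h4
  · exact absurd hAB (not_le.2 h1)
  · exact absurd hBC (not_le.2 h2)
  · exact absurd hCD (not_le.2 h3)
  · exact h4

/-- The rows of a passing cube check pass. [this work] -/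
theorem checkCube4Row_of_checkCube4 {m σ : ℕ} (h : checkCube4 m σ = true) {A : ℕ} (hA : A ∈ upsN m) :
    checkCube4Row m σ A = true := by
  unfold checkCube4 at h
  rw [List.all_eq_true] at h
  exact h A hA

/-- `checkCube4` certifies every sorted quadruple of increasing bitmasks. [this work] -/
theorem checkQuad_of_checkCube4 {m σ : ℕ} (h : checkCube4 m σ = true) {A B C D : ℕ} (hA : A ∈ upsN m)
    (hB : B ∈ upsN m) (hC : C ∈ upsN m) (hD : D ∈ upsN m) (hAB : A ≤ B) (hBC : B ≤ C) (hCD : C ≤ D) :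
    checkQuad σ m A B C D = true :=
  checkQuad_of_checkCube4Row (checkCube4Row_of_checkCube4 h hA) hB hC hD hAB hBC hCD

/-- Assembling a cube check from its rows. [this work] -/
theorem checkCube4_of_rows {m σ : ℕ} (h : ∀ A ∈ upsN m, checkCube4Row m σ A = true) : checkCube4 m σ = true := by
  unfold checkCube4
  rw [List.all_eq_true]
  exact h

end Summit.CriticalPhenomena.PercolationContinuityZ3.Theorems.SahiC4Cube
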